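import Literature.IUT.HodgeTheaters.PuncturedEllipticCoveringsCor12OfGeomOriginCor33i
import Literature.IUT.HodgeTheaters.PuncturedEllipticCoveringsCor12HextOfEx48
import HarnessLib

/-!
# [IUTchI] Cor. 1.2 at the genuine `K`-level data — the GRAND KNIT with its [AbsTopII] Cor. 3.3 interface binders RE-KEYED to
# FACT-LIST NAMES: «applicable in light of [AbsTopI], Example 4.8» (F-0193) over number fields (proof-only sequel)

Mochizuki, *Inter-universal Teichmüller theory I*, kurims manuscript (May 2020), §1 pp. 37–39, Corollary 1.2 and its proof
p. 39 l. 19–46, in particular l. 24–27 «the algorithms of [AbsTopII], Corollary 3.3, (i), (ii) — which are applicable in light of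
[AbsTopI], Example 4.8 — allow one to reconstruct `Π_C`» [cite: Mochizuki2012, IUTchI Cor 1.2 p.39] (D-0012 claim key; series
status DISPUTED — nothing of the series is asserted here); [AbsTopII] Cor. 3.3 (i) pp. 67–68 and Remark 3.3.1 p. 69
[cite: MochizukiAbsTopII2013, Rmk 3.3.1 p.69]; [AbsTopI] Example 4.8 (i) p. 58 [cite: MochizukiAbsTopI2012, Ex 4.8 (i) p.58];
[AbsAnab] Lemma 1.1.4 (i) p. 7 [cite: MochizukiAbsAnab2004, Lemma 1.1.4 (i) p.7].

PROOF-ONLY sequel (cell abc-iut, seat abc-iut-w6-d032 gen 7, row «COR12-GEOMORIGIN-EX48» — GO abc-iut-L5-t1 g11 04:28:35Z; HUB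
census `plan/L5/SUBDAG-IUTchI-Cor12.md`), ONE theorem, all by name: abc-iut-L5-t1's GRAND KNIT
`InitialThetaData.pe_characteristicNatureOfCoverings_of_geomOrigin_cor33i` (p496323) with its [AbsTopII] Cor. 3.3 INTERFACE
binders — the `𝒟`-hypotheses `hfull hdgc`, the standing hypotheses `hX hX′ hY hY′ : IsCor33Member`, and the [AbsAnab] Lem. 1.1.4 (i)
inputs `hmaxX hmaxX′ hmaxY hmaxY′` — RE-KEYED per this seat's R42 census (`PuncturedEllipticCoveringsCor12HextOfEx48.lean`, p496185):
* `hfull`, `hdgc` and the `slim`/`cyclotomic` fields of `IsCor33Member` ⟸ the class shape `𝒟.IsEx48ClassGen p` + the named fact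
  `𝒟.Ex_4_8_i p` (**F-0193**, BY NAME) — layer L4's `EllipticModel.isCor33Member_of_ex_4_8_i` ([AbsTopII] Rmk. 3.3.1);
* the remaining `IsCor33Member` fields ⟸ MEMBER DATA `hmem hadm hΔ hne` (the realised object is a member, `Π`-elliptically
  admissible, with slim `Δ ≠ 1`);
* `hmax…` ⟸ `GeomTFG` («`Δ` topologically finitely generated», [AbsTopI] Prop. 2.2 / F-0240 shape) over construction-data
  fields that are NUMBER FIELDS (universe `0`), by [AbsAnab] Thm. 1.1.2 — a tree theorem — through
  `geomIsMaxTFGNormalIn_top_of_geomTFG_of_numberField` (p496185) / `FundamentalExtension.geomIsMaxTFGNormalIn_of_nfBase`.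
DISPLAYED TELESCOPE of `InitialThetaData.pe_characteristicNatureOfCoverings_of_geomOrigin_ex48`:
DATA `C C′ A O O′` + model data `𝒟 M p bX bX′ bY bY′ X X′ Y Y′` with `[NumberField (𝒟.fld b)]` at the four bases, member data
`hmem hadm hΔ hne htfg` ×4, realisation data `ePi eC hcomp` ×4, `hS hSY` · FACT-INSTANCE `hEx : 𝒟.Ex_4_8_i p` (F-0193),
`h33 : M.Cor_3_3_i` (F-0294), `hA hA′` (F-0206) · CLASS SHAPE `h𝒟 : 𝒟.IsEx48ClassGen p` · GAP `h0 h0′` (G-L5d4g6-1) · LAW = the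
eight printed `Δ_ε`-level sentences `hL2a hL2c hL3 hL4` ×2, as in p496323.  Versus p496323: `hfull hdgc hX hX′ hY hY′ hmaxX hmaxX′
hmaxY hmaxY′` (10 interface binders) are GONE — replaced by ONE fact row (F-0193), one class-shape predicate and member data.

HONEST FRAMING: a by-name composition; the origin records, the model and the realisation data are assumption-shaped DATA asserted
for no instance (no `EllipticModel` over a genuine Example 4.8 class exists in the tree); typed ≠ discharged for F-0193/F-0294/F-0206
(FACT policy); nothing here bears on [IUTchIII] Cor. 3.12 or asserts that abc is proved or refuted.  No `def`, no instance, no new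
`Prop` fact.
-/

noncomputable section

open CategoryTheory Topology

namespace Literature.IUT.HodgeTheaters.InitialThetaData

open scoped Pointwise
open Literature.AlgebraicGeometry.Frobenioids (IsSlimGroup)
open Literature.AnabelianGeometry.AbsoluteAnabelian
open Literature.AnabelianGeometry.AbsoluteAnabelian.FundamentalExtension (CuspidalAlgorithm)
open Literature.AnabelianGeometry.AbsoluteAnabelian.AbsTopI (ConstructionDataClass)
open Literature.AnabelianGeometry.AbsoluteAnabelian.AbsTopII (EllipticModel)

universe u u'

variable {F : Type u} {K : Type} {Fbar : Type} [Field F] [NumberField F] [Field K] [NumberField K]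
  [Algebra F K] [Field Fbar] [Algebra F Fbar] [Algebra K Fbar]
  {E : WeierstrassCurve F} [E.IsElliptic] {l : ℕ} {Pb : BadPlacePredicates K}
  (D : InitialThetaData F K Fbar E l Pb)
  {F' : Type u'} {K' : Type} [Field F'] [NumberField F'] [Field K'] [NumberField K'] [Algebra F' K']
  {Fbar' : Type} [Field Fbar'] [Algebra F' Fbar'] [Algebra K' Fbar']
  {E' : WeierstrassCurve F'} [E'.IsElliptic] {l' : ℕ} {Pb' : BadPlacePredicates K'}
  (D' : InitialThetaData F' K' Fbar' E' l' Pb')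

/-- **[IUTchI] Cor. 1.2 between the `K`-level data of two initial Θ-data — GRAND KNIT over a class of [AbsTopI] Example 4.8 (i)**:
abc-iut-L5-t1's `pe_characteristicNatureOfCoverings_of_geomOrigin_cor33i` (p496323) with the [AbsTopII] Cor. 3.3 interface binders
re-keyed: the `𝒟`-hypotheses and «`G` slim, `χ_p` open» from F-0193 `𝒟.Ex_4_8_i p` at a class with `IsEx48ClassGen p`
(`EllipticModel.isCor33Member_of_ex_4_8_i`), the [AbsAnab] Lem. 1.1.4 (i) inputs from `GeomTFG` over NUMBER-FIELD construction-data
fields (`geomIsMaxTFGNormalIn_top_of_geomTFG_of_numberField`, [AbsAnab] Thm. 1.1.2 in tree).  LAW binders = the eight printed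
`Δ_ε`-sentences (L2a)(L2c)(L3)(L4) at the two data; FACT rows F-0193, F-0294, F-0206 by name; GAP G-L5d4g6-1; the rest DATA.
([IUTchI] Cor 1.2 p.39) [claim: Mochizuki2012, status: disputed] -/
theorem pe_characteristicNatureOfCoverings_of_geomOrigin_ex48
    (O : D.geom.pe.GeomOrigin) (O' : D'.geom.pe.GeomOrigin)
    (C : D.geom.pe.CuspGalois) (C' : D'.geom.pe.CuspGalois)
    -- a class of [AbsTopI] Example 4.8 (i) with its named fact F-0193, a Cor 3.3/3.4 model over it, F-0294 by name
    {𝒟 : ConstructionDataClass.{0}} {p : ℕ} [Fact p.Prime] (h𝒟 : 𝒟.IsEx48ClassGen p) (hEx : 𝒟.Ex_4_8_i p)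
    (M : EllipticModel 𝒟) (h33 : M.Cor_3_3_i)
    -- members X, X′ over number fields, realised by Π_{X̲→}, Π′_{X̲→} with k-cores Π_C, Π′_C
    {bX bX' : 𝒟.Base} [NumberField (𝒟.fld bX)] [NumberField (𝒟.fld bX')]
    {X : (𝒟.datum bX).Obj} {X' : (𝒟.datum bX').Obj}
    (hmemX : 𝒟.Mem bX X) (hadmX : M.IsEllipticallyAdmissible bX X) (hΔX : IsSlimGroup ((𝒟.datum bX).ext X).geom)
    (hneX : ((𝒟.datum bX).ext X).geom ≠ ⊥) (htfgX : ((𝒟.datum bX).ext X).GeomTFG)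
    (hmemX' : 𝒟.Mem bX' X') (hadmX' : M.IsEllipticallyAdmissible bX' X') (hΔX' : IsSlimGroup ((𝒟.datum bX').ext X').geom)
    (hneX' : ((𝒟.datum bX').ext X').geom ≠ ⊥) (htfgX' : ((𝒟.datum bX').ext X').GeomTFG)
    (hS : (𝒟.datum bX').primes = (𝒟.datum bX).primes)
    (ePi : ((𝒟.datum bX).ext X).arith ≃ₜ* D.geom.pe.piXarrow) (eC : (M.coreExt bX X).arith ≃ₜ* D.geom.pe.PiC)
    (hcomp : ∀ x, eC ((M.toCore bX X).arith x) = (ePi x : D.geom.pe.PiC))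
    (ePi' : ((𝒟.datum bX').ext X').arith ≃ₜ* D'.geom.pe.piXarrow) (eC' : (M.coreExt bX' X').arith ≃ₜ* D'.geom.pe.PiC)
    (hcomp' : ∀ x, eC' ((M.toCore bX' X').arith x) = (ePi' x : D'.geom.pe.PiC))
    -- members Y, Y′ over number fields, realised by Π_{C̲→}, Π′_{C̲→} with k-cores Π_C, Π′_C
    {bY bY' : 𝒟.Base} [NumberField (𝒟.fld bY)] [NumberField (𝒟.fld bY')]
    {Y : (𝒟.datum bY).Obj} {Y' : (𝒟.datum bY').Obj}
    (hmemY : 𝒟.Mem bY Y) (hadmY : M.IsEllipticallyAdmissible bY Y) (hΔY : IsSlimGroup ((𝒟.datum bY).ext Y).geom)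
    (hneY : ((𝒟.datum bY).ext Y).geom ≠ ⊥) (htfgY : ((𝒟.datum bY).ext Y).GeomTFG)
    (hmemY' : 𝒟.Mem bY' Y') (hadmY' : M.IsEllipticallyAdmissible bY' Y') (hΔY' : IsSlimGroup ((𝒟.datum bY').ext Y').geom)
    (hneY' : ((𝒟.datum bY').ext Y').geom ≠ ⊥) (htfgY' : ((𝒟.datum bY').ext Y').GeomTFG)
    (hSY : (𝒟.datum bY').primes = (𝒟.datum bY).primes)
    (fPi : ((𝒟.datum bY).ext Y).arith ≃ₜ* D.geom.pe.piCarrow) (fC : (M.coreExt bY Y).arith ≃ₜ* D.geom.pe.PiC)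
    (hcompY : ∀ x, fC ((M.toCore bY Y).arith x) = (fPi x : D.geom.pe.PiC))
    (fPi' : ((𝒟.datum bY').ext Y').arith ≃ₜ* D'.geom.pe.piCarrow) (fC' : (M.coreExt bY' Y').arith ≃ₜ* D'.geom.pe.PiC)
    (hcompY' : ∀ x, fC' ((M.toCore bY' Y').arith x) = (fPi' x : D'.geom.pe.PiC))
    -- the eight printed Δ_ε-level sentences (L2a)(L2c)(L3)(L4) at the two data
    (hL2a : D.geom.pe.deltaEpsKer.relIndex (D.geom.pe.inertia D.geom.pe.ε1 ⊔ D.geom.pe.deltaEpsKer) = D.geom.pe.l)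
    (hL2c : D.geom.pe.inertia D.geom.pe.ε1 ⊓ (D.geom.pe.inertia D.geom.pe.ε2 ⊔ D.geom.pe.deltaEpsKer) ≤
      D.geom.pe.deltaEpsKer)
    (hL3 : ∀ c ∈ D.geom.pe.DeltaCbar, c ∉ D.geom.pe.DeltaXbar → ∀ v ∈ D.geom.pe.DeltaXbar,
      c * v * c⁻¹ * v ∈ D.geom.pe.inertia D.geom.pe.ε1 ⊔ D.geom.pe.inertia D.geom.pe.ε2 ⊔ D.geom.pe.deltaEpsKer)
    (hL4 : ∀ x : D.geom.pe.Cusp, ∀ g ∈ D.geom.pe.PiXbar, ∀ z ∈ D.geom.pe.inertia x,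
      g * z * g⁻¹ * z⁻¹ ∈ D.geom.pe.modLKer)
    (hL2a' : D'.geom.pe.deltaEpsKer.relIndex (D'.geom.pe.inertia D'.geom.pe.ε1 ⊔ D'.geom.pe.deltaEpsKer) =
      D'.geom.pe.l)
    (hL2c' : D'.geom.pe.inertia D'.geom.pe.ε1 ⊓ (D'.geom.pe.inertia D'.geom.pe.ε2 ⊔ D'.geom.pe.deltaEpsKer) ≤
      D'.geom.pe.deltaEpsKer)
    (hL3' : ∀ c ∈ D'.geom.pe.DeltaCbar, c ∉ D'.geom.pe.DeltaXbar → ∀ v ∈ D'.geom.pe.DeltaXbar,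
      c * v * c⁻¹ * v ∈
        D'.geom.pe.inertia D'.geom.pe.ε1 ⊔ D'.geom.pe.inertia D'.geom.pe.ε2 ⊔ D'.geom.pe.deltaEpsKer)
    (hL4' : ∀ x : D'.geom.pe.Cusp, ∀ g ∈ D'.geom.pe.PiXbar, ∀ z ∈ D'.geom.pe.inertia x,
      g * z * g⁻¹ * z⁻¹ ∈ D'.geom.pe.modLKer)
    -- ramification of ε⁰ (GAP G-L5d4g6-1) and [AbsTopI] Lem 4.5 (v) (F-0206)
    (h0 : ¬ D.geom.pe.inertia D.geom.pe.ε0 ≤ D.geom.pe.piXarrow)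
    (h0' : ¬ D'.geom.pe.inertia D'.geom.pe.ε0 ≤ D'.geom.pe.piXarrow)
    (A : CuspidalAlgorithm.{0}) (hA : A.RecoversCusps D.geom.pe.extXbar C.cuspidalDataXbar)
    (hA' : A.RecoversCusps D'.geom.pe.extXbar C'.cuspidalDataXbar) :
    D.geom.pe.CharacteristicNatureOfCoverings D'.geom.pe :=
  D.pe_characteristicNatureOfCoverings_of_geomOrigin_cor33i D' O O' C C' M h33 (hEx h𝒟).1 (hEx h𝒟).2.1
    (M.isCor33Member_of_ex_4_8_i h𝒟 hEx hmemX hadmX hΔX hneX) (M.isCor33Member_of_ex_4_8_i h𝒟 hEx hmemX' hadmX' hΔX' hneX')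
    hS (geomIsMaxTFGNormalIn_top_of_geomTFG_of_numberField X htfgX)
    (geomIsMaxTFGNormalIn_top_of_geomTFG_of_numberField X' htfgX') ePi eC hcomp ePi' eC' hcomp'
    (M.isCor33Member_of_ex_4_8_i h𝒟 hEx hmemY hadmY hΔY hneY) (M.isCor33Member_of_ex_4_8_i h𝒟 hEx hmemY' hadmY' hΔY' hneY')
    hSY (geomIsMaxTFGNormalIn_top_of_geomTFG_of_numberField Y htfgY)
    (geomIsMaxTFGNormalIn_top_of_geomTFG_of_numberField Y' htfgY') fPi fC hcompY fPi' fC' hcompY'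
    hL2a hL2c hL3 hL4 hL2a' hL2c' hL3' hL4' h0 h0' A hA hA'

end Literature.IUT.HodgeTheaters.InitialThetaData
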